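import Summits.CriticalPhenomena.PercolationContinuityZ3.Theorems.Transplant.FKDoubleFanOneSidedConeSDeg
import Summits.CriticalPhenomena.PercolationContinuityZ3.Theorems.Transplant.FKDoubleFanOneSidedConeSInputs
import HarnessLib

/-!
# Double fans `K₂ ∨ P_{m+1}`: `HypBaS` from EIGHT CELL FAMILIES — the finite programme for the far cross-apex theorem (all middles)

Helper file (`--supports stmt-CriticalPhenomena-4575`), FK sub-lane `prim-bschramm-fk-3` (gen 37); builds on p205010 (kernel theorem, internal audit
signed; external expert review pending).  No named facts, no sorries; standard axioms.  Memo `bschramm/prim-bschramm-fk-3/FAR-CROSS-XII.md` §5–§7.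

Assembly of `…ConeSGadgets`/`…ConeSDeg` (gadget leg: degenerate gadgets discharged, `Λ`-floor and roof gadgets remain) with `…ConeSInputs` (rest leg:
degenerate frame, `AB∗AC`-type states, `AB∗BC`-type states, roof points): **`hypBaS_of_cells`** — the single closure statement `HypBaS q` of
`…OneSidedConeS`, and with it (`negCorr_spokes_cross_far_of_hypBaS`) the negative correlation of every cross-apex pair of every weighted double fan for
every middle word, follows from the cone memberships `opBC y' (imgA q G w) ∈ osConeS q` for
  `G ∈ {Λ-floor gadgets swapAC (swapAB (vecB q W y X Z u_Λ)) (3 parameters), roof gadgets swapAC (swapAB (roofV q κ l t w₁)) (2 parameters)}` ×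
  `w ∈ {degenerate frame, AB∗AC-type states (1), AB∗BC-type states (2), roof points roofV (2)}` × `y' ∈ [0,1]`
(`0 < q < 1`).  Every cell is an honest instance of `HypBaS` (numerically a member in all tests, memo §5); the degenerate-gadget cells are the one-atom
identity `opBC_cutBiv` and are already discharged.  **`negCorr_spokes_cross_far_of_cells`** records the end-to-end statement.
[folklore]
-/

noncomputable section

namespace Summit.CriticalPhenomena.PercolationContinuityZ3.Theorems

namespace FK

namespace ThreeApex

/-- **`HypBaS` from the eight cell families** (gadget ∈ {`Λ`-floor, roof} × rest ∈ {degenerate, `AB∗AC`-type, `AB∗BC`-type, roof};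
`0 < q < 1`). [folklore] -/
theorem hypBaS_of_cells {q : ℝ} (hq0 : 0 < q) (hq1 : q < 1)
    (h_lam_deg : ∀ W y X Z uL : ℝ, 0 ≤ X → 0 ≤ Z → 0 ≤ uL → uL ≤ y → q * y < W → 0 ≤ W - q * y - X - Z →
      uL * (W - q * y) = X * y + X * Z + y * Z → ∀ y' : ℝ, 0 ≤ y' → y' ≤ 1 →
      ∀ y₂ u₂ : ℝ, 0 ≤ u₂ → u₂ ≤ y₂ → opBC y' (imgA q (swapAC (swapAB (vecB q W y X Z uL))) (vecB q (q * y₂) y₂ 0 0 u₂)) ∈ osConeS q)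
    (h_lam_AC : ∀ W y X Z uL : ℝ, 0 ≤ X → 0 ≤ Z → 0 ≤ uL → uL ≤ y → q * y < W → 0 ≤ W - q * y - X - Z →
      uL * (W - q * y) = X * y + X * Z + y * Z → ∀ y' : ℝ, 0 ≤ y' → y' ≤ 1 →
      ∀ W₂ y₂ X₂ : ℝ, 0 ≤ X₂ → 0 ≤ y₂ → q * y₂ < W₂ → X₂ ≤ W₂ - q * y₂ → opBC y' (imgA q (swapAC (swapAB (vecB q W y X Z uL))) (vecB q W₂ y₂ X₂ 0 (X₂ * y₂ / (W₂ - q * y₂)))) ∈ osConeS q)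
    (h_lam_BC : ∀ W y X Z uL : ℝ, 0 ≤ X → 0 ≤ Z → 0 ≤ uL → uL ≤ y → q * y < W → 0 ≤ W - q * y - X - Z →
      uL * (W - q * y) = X * y + X * Z + y * Z → ∀ y' : ℝ, 0 ≤ y' → y' ≤ 1 →
      ∀ W₂ y₂ X₂ Z₂ : ℝ, 0 ≤ X₂ → 0 ≤ Z₂ → 0 ≤ y₂ → q * y₂ < W₂ → Z₂ ≤ W₂ - q * y₂ - X₂ →
        y₂ * (W₂ - q * y₂ - X₂ - Z₂) = X₂ * Z₂ → opBC y' (imgA q (swapAC (swapAB (vecB q W y X Z uL))) (vecB q W₂ y₂ X₂ Z₂ y₂)) ∈ osConeS q)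
    (h_lam_roof : ∀ W y X Z uL : ℝ, 0 ≤ X → 0 ≤ Z → 0 ≤ uL → uL ≤ y → q * y < W → 0 ≤ W - q * y - X - Z →
      uL * (W - q * y) = X * y + X * Z + y * Z → ∀ y' : ℝ, 0 ≤ y' → y' ≤ 1 →
      ∀ κ₂ l₂ t₂ w₂ : ℝ, 0 ≤ κ₂ → 0 < l₂ → 0 ≤ t₂ → 0 ≤ w₂ → w₂ ≤ 1 → opBC y' (imgA q (swapAC (swapAB (vecB q W y X Z uL))) (roofV q κ₂ l₂ t₂ w₂)) ∈ osConeS q)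
    (h_roof_deg : ∀ κ l t w₁ : ℝ, 0 ≤ κ → 0 < l → 0 ≤ t → 0 ≤ w₁ → w₁ ≤ 1 → ∀ y' : ℝ, 0 ≤ y' → y' ≤ 1 →
      ∀ y₂ u₂ : ℝ, 0 ≤ u₂ → u₂ ≤ y₂ → opBC y' (imgA q (swapAC (swapAB (roofV q κ l t w₁))) (vecB q (q * y₂) y₂ 0 0 u₂)) ∈ osConeS q)
    (h_roof_AC : ∀ κ l t w₁ : ℝ, 0 ≤ κ → 0 < l → 0 ≤ t → 0 ≤ w₁ → w₁ ≤ 1 → ∀ y' : ℝ, 0 ≤ y' → y' ≤ 1 →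
      ∀ W₂ y₂ X₂ : ℝ, 0 ≤ X₂ → 0 ≤ y₂ → q * y₂ < W₂ → X₂ ≤ W₂ - q * y₂ → opBC y' (imgA q (swapAC (swapAB (roofV q κ l t w₁))) (vecB q W₂ y₂ X₂ 0 (X₂ * y₂ / (W₂ - q * y₂)))) ∈ osConeS q)
    (h_roof_BC : ∀ κ l t w₁ : ℝ, 0 ≤ κ → 0 < l → 0 ≤ t → 0 ≤ w₁ → w₁ ≤ 1 → ∀ y' : ℝ, 0 ≤ y' → y' ≤ 1 →
      ∀ W₂ y₂ X₂ Z₂ : ℝ, 0 ≤ X₂ → 0 ≤ Z₂ → 0 ≤ y₂ → q * y₂ < W₂ → Z₂ ≤ W₂ - q * y₂ - X₂ →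
        y₂ * (W₂ - q * y₂ - X₂ - Z₂) = X₂ * Z₂ → opBC y' (imgA q (swapAC (swapAB (roofV q κ l t w₁))) (vecB q W₂ y₂ X₂ Z₂ y₂)) ∈ osConeS q)
    (h_roof_roof : ∀ κ l t w₁ : ℝ, 0 ≤ κ → 0 < l → 0 ≤ t → 0 ≤ w₁ → w₁ ≤ 1 → ∀ y' : ℝ, 0 ≤ y' → y' ≤ 1 →
      ∀ κ₂ l₂ t₂ w₂ : ℝ, 0 ≤ κ₂ → 0 < l₂ → 0 ≤ t₂ → 0 ≤ w₂ → w₂ ≤ 1 → opBC y' (imgA q (swapAC (swapAB (roofV q κ l t w₁))) (roofV q κ₂ l₂ t₂ w₂)) ∈ osConeS q) :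
    HypBaS q :=
  hypBaS_of_lamfloor_roof hq0 hq1
    (fun _ _ W y X Z uL hw hy0 hy1 hX hZ hL0 hLy hW h1 hfl =>
      opBC_imgA_mem_of_twoletter hq0 hq1
        (fun y₂ u₂ hu0 hu1 => h_lam_deg W y X Z uL hX hZ hL0 hLy hW h1 hfl _ hy0 hy1 y₂ u₂ hu0 hu1)
        (fun W₂ y₂ X₂ hX₂ hy₂ hW₂ hXl => h_lam_AC W y X Z uL hX hZ hL0 hLy hW h1 hfl _ hy0 hy1 W₂ y₂ X₂ hX₂ hy₂ hW₂ hXl)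
        (fun W₂ y₂ X₂ Z₂ hX₂ hZ₂ hy₂ hW₂ hZl hrel => h_lam_BC W y X Z uL hX hZ hL0 hLy hW h1 hfl _ hy0 hy1 W₂ y₂ X₂ Z₂ hX₂ hZ₂ hy₂ hW₂ hZl hrel)
        (fun κ₂ l₂ t₂ w₂ hκ hl ht hw0 hw1 => h_lam_roof W y X Z uL hX hZ hL0 hLy hW h1 hfl _ hy0 hy1 κ₂ l₂ t₂ w₂ hκ hl ht hw0 hw1)
        hw.valid.nonneg hw.valid.lam hw.ub)
    (fun _ _ κ l t w₁ hw hy0 hy1 hκ hl ht hw0 hw1 =>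
      opBC_imgA_mem_of_twoletter hq0 hq1
        (fun y₂ u₂ hu0 hu1 => h_roof_deg κ l t w₁ hκ hl ht hw0 hw1 _ hy0 hy1 y₂ u₂ hu0 hu1)
        (fun W₂ y₂ X₂ hX₂ hy₂ hW₂ hXl => h_roof_AC κ l t w₁ hκ hl ht hw0 hw1 _ hy0 hy1 W₂ y₂ X₂ hX₂ hy₂ hW₂ hXl)
        (fun W₂ y₂ X₂ Z₂ hX₂ hZ₂ hy₂ hW₂ hZl hrel => h_roof_BC κ l t w₁ hκ hl ht hw0 hw1 _ hy0 hy1 W₂ y₂ X₂ Z₂ hX₂ hZ₂ hy₂ hW₂ hZl hrel)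
        (fun κ₂ l₂ t₂ w₂ hκ₂ hl₂ ht₂ hw0₂ hw1₂ => h_roof_roof κ l t w₁ hκ hl ht hw0 hw1 _ hy0 hy1 κ₂ l₂ t₂ w₂ hκ₂ hl₂ ht₂ hw0₂ hw1₂)
        hw.valid.nonneg hw.valid.lam hw.ub)

open MeasureTheory Literature.Probability.LatticeModels Literature.Probability.Percolation
open scoped Classical

variable {V : Type*} [Fintype V]

section Setting

variable {a b : V} {c : ℕ → V} {m : ℕ}
variable (hab : a ≠ b) (hinj : ∀ j k, j ≤ m → k ≤ m → c j = c k → j = k) (hca : ∀ j, j ≤ m → c j ≠ a) (hcb : ∀ j, j ≤ m → c j ≠ b)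
include hab hinj hca hcb

/-- **THE FINITE PROGRAMME, END TO END.**  If the eight cell families hold at `q ∈ (0,1)`, then for every weighted double fan (`card V = m + 3`,
weights supported on the double-fan pairs) and all `j < k ≤ m`: `φ(J_{a c_j} ∩ J_{b c_k}) ≤ φ(J_{a c_j})·φ(J_{b c_k})` — every middle word, every
distance. [folklore] -/
theorem negCorr_spokes_cross_far_of_cells (hcard : Fintype.card V = m + 3) {q : ℝ} (hq0 : 0 < q) (hq1 : q < 1)
    (w : Sym2 V → unitInterval) (hsupp : ∀ e, e ∉ dfPairs a b c m → w e = 0)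
    (h_lam_deg : ∀ W y X Z uL : ℝ, 0 ≤ X → 0 ≤ Z → 0 ≤ uL → uL ≤ y → q * y < W → 0 ≤ W - q * y - X - Z →
      uL * (W - q * y) = X * y + X * Z + y * Z → ∀ y' : ℝ, 0 ≤ y' → y' ≤ 1 →
      ∀ y₂ u₂ : ℝ, 0 ≤ u₂ → u₂ ≤ y₂ → opBC y' (imgA q (swapAC (swapAB (vecB q W y X Z uL))) (vecB q (q * y₂) y₂ 0 0 u₂)) ∈ osConeS q)
    (h_lam_AC : ∀ W y X Z uL : ℝ, 0 ≤ X → 0 ≤ Z → 0 ≤ uL → uL ≤ y → q * y < W → 0 ≤ W - q * y - X - Z →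
      uL * (W - q * y) = X * y + X * Z + y * Z → ∀ y' : ℝ, 0 ≤ y' → y' ≤ 1 →
      ∀ W₂ y₂ X₂ : ℝ, 0 ≤ X₂ → 0 ≤ y₂ → q * y₂ < W₂ → X₂ ≤ W₂ - q * y₂ → opBC y' (imgA q (swapAC (swapAB (vecB q W y X Z uL))) (vecB q W₂ y₂ X₂ 0 (X₂ * y₂ / (W₂ - q * y₂)))) ∈ osConeS q)
    (h_lam_BC : ∀ W y X Z uL : ℝ, 0 ≤ X → 0 ≤ Z → 0 ≤ uL → uL ≤ y → q * y < W → 0 ≤ W - q * y - X - Z →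
      uL * (W - q * y) = X * y + X * Z + y * Z → ∀ y' : ℝ, 0 ≤ y' → y' ≤ 1 →
      ∀ W₂ y₂ X₂ Z₂ : ℝ, 0 ≤ X₂ → 0 ≤ Z₂ → 0 ≤ y₂ → q * y₂ < W₂ → Z₂ ≤ W₂ - q * y₂ - X₂ →
        y₂ * (W₂ - q * y₂ - X₂ - Z₂) = X₂ * Z₂ → opBC y' (imgA q (swapAC (swapAB (vecB q W y X Z uL))) (vecB q W₂ y₂ X₂ Z₂ y₂)) ∈ osConeS q)
    (h_lam_roof : ∀ W y X Z uL : ℝ, 0 ≤ X → 0 ≤ Z → 0 ≤ uL → uL ≤ y → q * y < W → 0 ≤ W - q * y - X - Z →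
      uL * (W - q * y) = X * y + X * Z + y * Z → ∀ y' : ℝ, 0 ≤ y' → y' ≤ 1 →
      ∀ κ₂ l₂ t₂ w₂ : ℝ, 0 ≤ κ₂ → 0 < l₂ → 0 ≤ t₂ → 0 ≤ w₂ → w₂ ≤ 1 → opBC y' (imgA q (swapAC (swapAB (vecB q W y X Z uL))) (roofV q κ₂ l₂ t₂ w₂)) ∈ osConeS q)
    (h_roof_deg : ∀ κ l t w₁ : ℝ, 0 ≤ κ → 0 < l → 0 ≤ t → 0 ≤ w₁ → w₁ ≤ 1 → ∀ y' : ℝ, 0 ≤ y' → y' ≤ 1 →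
      ∀ y₂ u₂ : ℝ, 0 ≤ u₂ → u₂ ≤ y₂ → opBC y' (imgA q (swapAC (swapAB (roofV q κ l t w₁))) (vecB q (q * y₂) y₂ 0 0 u₂)) ∈ osConeS q)
    (h_roof_AC : ∀ κ l t w₁ : ℝ, 0 ≤ κ → 0 < l → 0 ≤ t → 0 ≤ w₁ → w₁ ≤ 1 → ∀ y' : ℝ, 0 ≤ y' → y' ≤ 1 →
      ∀ W₂ y₂ X₂ : ℝ, 0 ≤ X₂ → 0 ≤ y₂ → q * y₂ < W₂ → X₂ ≤ W₂ - q * y₂ → opBC y' (imgA q (swapAC (swapAB (roofV q κ l t w₁))) (vecB q W₂ y₂ X₂ 0 (X₂ * y₂ / (W₂ - q * y₂)))) ∈ osConeS q)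
    (h_roof_BC : ∀ κ l t w₁ : ℝ, 0 ≤ κ → 0 < l → 0 ≤ t → 0 ≤ w₁ → w₁ ≤ 1 → ∀ y' : ℝ, 0 ≤ y' → y' ≤ 1 →
      ∀ W₂ y₂ X₂ Z₂ : ℝ, 0 ≤ X₂ → 0 ≤ Z₂ → 0 ≤ y₂ → q * y₂ < W₂ → Z₂ ≤ W₂ - q * y₂ - X₂ →
        y₂ * (W₂ - q * y₂ - X₂ - Z₂) = X₂ * Z₂ → opBC y' (imgA q (swapAC (swapAB (roofV q κ l t w₁))) (vecB q W₂ y₂ X₂ Z₂ y₂)) ∈ osConeS q)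
    (h_roof_roof : ∀ κ l t w₁ : ℝ, 0 ≤ κ → 0 < l → 0 ≤ t → 0 ≤ w₁ → w₁ ≤ 1 → ∀ y' : ℝ, 0 ≤ y' → y' ≤ 1 →
      ∀ κ₂ l₂ t₂ w₂ : ℝ, 0 ≤ κ₂ → 0 < l₂ → 0 ≤ t₂ → 0 ≤ w₂ → w₂ ≤ 1 → opBC y' (imgA q (swapAC (swapAB (roofV q κ l t w₁))) (roofV q κ₂ l₂ t₂ w₂)) ∈ osConeS q)
    {j k : ℕ} (hjk : j < k) (hk : k ≤ m) :
    (rcMeasureW w q ∅).real ({ω : BondConfig V | s(a, c j) ∈ ω} ∩ {ω | s(b, c k) ∈ ω}) ≤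
      (rcMeasureW w q ∅).real {ω : BondConfig V | s(a, c j) ∈ ω} * (rcMeasureW w q ∅).real {ω : BondConfig V | s(b, c k) ∈ ω} :=
  negCorr_spokes_cross_far_of_hypBaS hab hinj hca hcb hcard hq0 hq1.le w hsupp
    (hypBaS_of_cells hq0 hq1 h_lam_deg h_lam_AC h_lam_BC h_lam_roof h_roof_deg h_roof_AC h_roof_BC h_roof_roof) hjk hk

end Setting

end ThreeApex

end FK

end Summit.CriticalPhenomena.PercolationContinuityZ3.Theorems
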